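import Mathlib
import HarnessLib

/-!
# Plane-wave spectral transform of the harmonic lattice operator (stub C of crux `DressedCharge`)

Stub `stub_planeWaveLink` (stub C) of line `birth` of the crux
`Summit.AtomisticToContinuum.FouriersLaw.Theses.HiddenChargeMazur.DressedCharge`
(item stmt-AtomisticToContinuum-13509, route `HiddenChargeMazur`); a `--supports` file, it closes
no item by itself. Pure commutative algebra in lattice polynomial rings `MvPolynomial σ R`
(for the chain: `σ = ℤ ⊕ ℤ`, `X (inl x) = q_x`, `X (inr x) = p_x`), no named facts, no new
definitions, no notation: the concrete operators are written out in full only in the registered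
statement; everything before it is stated for ARBITRARY derivations subject to generator
identities, so that it can be re-used for other tuples of waves / other operators.

## Content

* Generic propagation lemmas for derivations of `MvPolynomial σ R`:
  `planeWave_comm_of_X` (a bracket identity `D ∘ E = E ∘ D + c • D` holds as soon as it holds on
  the generators — the bracket of derivations is a derivation, `MvPolynomial.derivation_ext`),
  `planeWave_rename_of_X` (a twisted equivariance `D ∘ rename s = z • rename s ∘ D` holds as soon
  as it holds on generators — induction on polynomials), and the degree drop
  `planeWave_totalDegree_mkDerivation_le` of a derivation with constant coefficients.
* Their iterates along a list: for a family `D : ι → Derivation` and `l : List ι` the iterated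
  derivative `𝐃_l f = l.foldr (fun i acc => D i acc) f = D_{l₀} (D_{l₁} (⋯ f))` is linear
  (`planeWave_iter_add/sub/smul/C_mul`), satisfies `𝐃_l ∘ E = (E + Σ c_i) ∘ 𝐃_l`
  (`planeWave_iter_comm`), `𝐃_l ∘ rename s = (Π c_i) • rename s ∘ 𝐃_l` (`planeWave_iter_rename`),
  lowers the total degree by `length l` (`planeWave_iter_totalDegree_le`, `planeWave_iter_eq_C`),
  and hence the abstract link `planeWave_link_generic`:
  `constantCoeff (𝐃_l (E (E w) + (C a * w - rename s w - rename t w)))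
    = ((Σ μ_i)² + (a - Π z_i - Π z'_i)) * constantCoeff (𝐃_l w)`
  whenever `totalDegree w ≤ length l`.
* The harmonic chain: for the harmonic Liouville derivation
  `L₁ = mkDerivation (q_x ↦ p_x, p_x ↦ -(ω₂+2) q_x + q_{x+1} + q_{x-1})`, the shifts
  `τ^{±1} = rename (Sum.map (· ± 1) (· ± 1))` and the complex plane-wave derivations
  `D_(z,μ) = mkDerivation (q_x ↦ z ^ x, p_x ↦ μ z ^ x)` (`x : ℤ`, integer powers), ADMISSIBLE when
  `z ≠ 0` and `μ ^ 2 = -ω̃(z)`, `ω̃(z) = ω₂ + 2 - z - z⁻¹` (for `z = e^{ik}` the squared dispersion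
  relation of the pinned harmonic chain): `[D_(z,μ), L₁] = μ • D_(z,μ)` (`planeWave_bracket`),
  `D ∘ τ = z • τ ∘ D` (`planeWave_shift_up`), `D ∘ τ⁻¹ = z⁻¹ • τ⁻¹ ∘ D` (`planeWave_shift_down`).
* The registered statement `stub_planeWaveLink`: for `P : Fin n → ℂ × ℂ` admissible,
  `𝐃_P = D_{P 0} ∘ ⋯ ∘ D_{P (n-1)}` (`List.ofFn`), `𝒟₀ w = L₁ (L₁ w) + ((ω₂+2) w - τ w - τ⁻¹ w)`
  and `totalDegree w ≤ n`:
  `constantCoeff (𝐃_P (𝒟₀ w)) = ((Σ μ_j)² + ω̃(Π z_j)) * constantCoeff (𝐃_P w)`.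
-/

noncomputable section

open MvPolynomial

namespace Summit.AtomisticToContinuum.FouriersLaw.Theorems.DressedCharge

section Generic

variable {R : Type*} [CommRing R] {σ ι : Type*}

/-- **Commutator identities propagate from generators.** If two derivations `D E` of
`MvPolynomial σ R` satisfy `D (E (X i)) = E (D (X i)) + c • D (X i)` on every generator, then
`D (E f) = E (D f) + c • D f` for every `f` (the bracket `⁅D, E⁆ - c • D` is a derivation
vanishing on generators, `MvPolynomial.derivation_ext`). -/
theorem planeWave_comm_of_X (D E : Derivation R (MvPolynomial σ R) (MvPolynomial σ R)) (c : R)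
    (h : ∀ i, D (E (X i)) = E (D (X i)) + c • D (X i)) (f : MvPolynomial σ R) :
    D (E f) = E (D f) + c • D f := by
  have key : ⁅D, E⁆ = c • D := by
    refine derivation_ext (fun i => ?_)
    rw [Derivation.commutator_apply, h, Derivation.smul_apply]
    abel
  have hf := congrArg (fun T : Derivation R (MvPolynomial σ R) (MvPolynomial σ R) => T f) key
  simp only [Derivation.commutator_apply, Derivation.smul_apply] at hf
  rw [← hf]
  abel

/-- **Twisted equivariance propagates from generators.** If a derivation `D` of
`MvPolynomial σ R` and a renaming `s : σ → σ` satisfy `D (X (s i)) = z • rename s (D (X i))`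
on every generator, then `D (rename s f) = z • rename s (D f)` for every `f`
(induction on `f`, Leibniz rule). -/
theorem planeWave_rename_of_X (D : Derivation R (MvPolynomial σ R) (MvPolynomial σ R))
    (s : σ → σ) (z : R) (h : ∀ i, D (X (s i)) = z • rename s (D (X i)))
    (f : MvPolynomial σ R) : D (rename s f) = z • rename s (D f) := by
  induction f using MvPolynomial.induction_on with
  | C a => simp
  | add p q hp hq => rw [map_add, map_add, hp, hq, map_add, map_add, smul_add]
  | mul_X p i hp =>
    simp only [map_mul, rename_X, Derivation.leibniz, smul_eq_mul, hp, h, map_add,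
      smul_eq_C_mul]
    ring

/-- **A derivation with constant coefficients lowers the total degree by one.** If every
`h i` is a constant (`totalDegree (h i) = 0`), then
`totalDegree (mkDerivation R h f) ≤ totalDegree f - 1` (truncated subtraction; for a constant
`f` both sides vanish). Proof: expand `f` into monomials and use `mkDerivation_monomial`. -/
theorem planeWave_totalDegree_mkDerivation_le (h : σ → MvPolynomial σ R)
    (hh : ∀ i, (h i).totalDegree = 0) (f : MvPolynomial σ R) :
    (mkDerivation R h f).totalDegree ≤ f.totalDegree - 1 := by
  classical
  conv_lhs => rw [f.as_sum]
  rw [map_sum]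
  refine totalDegree_finsetSum_le fun s hs => ?_
  rw [mkDerivation_monomial, Finsupp.sum]
  refine (totalDegree_smul_le _ _).trans (totalDegree_finsetSum_le fun i hi => ?_)
  rw [smul_eq_mul]
  refine (totalDegree_mul _ _).trans ?_
  rw [hh, add_zero]
  refine (totalDegree_monomial_le _ _).trans ?_
  have hle : Finsupp.single i 1 ≤ s := by
    rw [Finsupp.single_le_iff]
    exact Nat.one_le_iff_ne_zero.mpr (Finsupp.mem_support_iff.mp hi)
  have hs' := le_totalDegree hs
  have hsplit : ((s - Finsupp.single i 1).sum fun _ ↦ id) + 1 = s.sum fun _ e => e := by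
    conv_rhs => rw [← tsub_add_cancel_of_le hle]
    rw [Finsupp.sum_add_index' (fun _ => rfl) (fun _ _ _ => rfl), Finsupp.sum_single_index rfl]
    rfl
  omega

/-! ### Iterating a family of derivations along a list

For `D : ι → Derivation R (MvPolynomial σ R) (MvPolynomial σ R)` and `l : List ι` the iterated
derivative of `f` is `l.foldr (fun i acc => D i acc) f = D_{l₀} (D_{l₁} (⋯ (D_{l_{k-1}} f)))`. -/

/-- The iterated derivative is additive. -/
theorem planeWave_iter_add (D : ι → Derivation R (MvPolynomial σ R) (MvPolynomial σ R))
    (l : List ι) (f g : MvPolynomial σ R) :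
    l.foldr (fun i acc => D i acc) (f + g) =
      l.foldr (fun i acc => D i acc) f + l.foldr (fun i acc => D i acc) g := by
  induction l with
  | nil => simp only [List.foldr_nil]
  | cons i l ih => simp only [List.foldr_cons, ih, map_add]

/-- The iterated derivative commutes with subtraction. -/
theorem planeWave_iter_sub (D : ι → Derivation R (MvPolynomial σ R) (MvPolynomial σ R))
    (l : List ι) (f g : MvPolynomial σ R) :
    l.foldr (fun i acc => D i acc) (f - g) =
      l.foldr (fun i acc => D i acc) f - l.foldr (fun i acc => D i acc) g := by
  induction l with
  | nil => simp only [List.foldr_nil]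
  | cons i l ih => simp only [List.foldr_cons, ih, map_sub]

/-- The iterated derivative is `R`-homogeneous. -/
theorem planeWave_iter_smul (D : ι → Derivation R (MvPolynomial σ R) (MvPolynomial σ R))
    (l : List ι) (a : R) (f : MvPolynomial σ R) :
    l.foldr (fun i acc => D i acc) (a • f) = a • l.foldr (fun i acc => D i acc) f := by
  induction l with
  | nil => simp only [List.foldr_nil]
  | cons i l ih => simp only [List.foldr_cons, ih, Derivation.map_smul]

/-- The iterated derivative commutes with multiplication by constants. -/
theorem planeWave_iter_C_mul (D : ι → Derivation R (MvPolynomial σ R) (MvPolynomial σ R))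
    (l : List ι) (a : R) (f : MvPolynomial σ R) :
    l.foldr (fun i acc => D i acc) (C a * f) = C a * l.foldr (fun i acc => D i acc) f := by
  rw [← smul_eq_C_mul, ← smul_eq_C_mul, planeWave_iter_smul]

/-- **Iterated bracket relation.** If `D i ∘ E = E ∘ D i + c i • D i` for every `i ∈ l`, then
`𝐃_l (E f) = E (𝐃_l f) + (Σ_{i ∈ l} c i) • 𝐃_l f`. -/
theorem planeWave_iter_comm (D : ι → Derivation R (MvPolynomial σ R) (MvPolynomial σ R))
    (E : Derivation R (MvPolynomial σ R) (MvPolynomial σ R)) (c : ι → R) (l : List ι)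
    (h : ∀ i ∈ l, ∀ f, D i (E f) = E (D i f) + c i • D i f) (f : MvPolynomial σ R) :
    l.foldr (fun i acc => D i acc) (E f) =
      E (l.foldr (fun i acc => D i acc) f) + (l.map c).sum • l.foldr (fun i acc => D i acc) f := by
  induction l with
  | nil => simp only [List.foldr_nil, List.map_nil, List.sum_nil, zero_smul, add_zero]
  | cons i l ih =>
    rw [List.forall_mem_cons] at h
    rw [List.foldr_cons, List.foldr_cons, ih h.2, map_add, Derivation.map_smul, h.1,
      List.map_cons, List.sum_cons, add_smul]
    abel

/-- **Iterated twisted equivariance.** If `D i ∘ rename s = c i • rename s ∘ D i` for every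
`i ∈ l`, then `𝐃_l (rename s f) = (Π_{i ∈ l} c i) • rename s (𝐃_l f)`. -/
theorem planeWave_iter_rename (D : ι → Derivation R (MvPolynomial σ R) (MvPolynomial σ R))
    (s : σ → σ) (c : ι → R) (l : List ι)
    (h : ∀ i ∈ l, ∀ f, D i (rename s f) = c i • rename s (D i f)) (f : MvPolynomial σ R) :
    l.foldr (fun i acc => D i acc) (rename s f) =
      (l.map c).prod • rename s (l.foldr (fun i acc => D i acc) f) := by
  induction l with
  | nil => simp only [List.foldr_nil, List.map_nil, List.prod_nil, one_smul]
  | cons i l ih =>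
    rw [List.forall_mem_cons] at h
    rw [List.foldr_cons, List.foldr_cons, ih h.2, Derivation.map_smul, h.1, smul_smul,
      List.map_cons, List.prod_cons, mul_comm]

/-- **Degree drop.** If every `D i`, `i ∈ l`, lowers the total degree by one, then
`totalDegree (𝐃_l f) ≤ totalDegree f - length l`. -/
theorem planeWave_iter_totalDegree_le
    (D : ι → Derivation R (MvPolynomial σ R) (MvPolynomial σ R)) (l : List ι)
    (h : ∀ i ∈ l, ∀ f, (D i f).totalDegree ≤ f.totalDegree - 1) (f : MvPolynomial σ R) :
    (l.foldr (fun i acc => D i acc) f).totalDegree ≤ f.totalDegree - l.length := by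
  induction l with
  | nil => simp only [List.foldr_nil, List.length_nil, Nat.sub_zero, le_refl]
  | cons i l ih =>
    rw [List.forall_mem_cons] at h
    rw [List.foldr_cons, List.length_cons]
    refine (h.1 _).trans ?_
    have := ih h.2
    omega

/-- **Constancy.** If every `D i`, `i ∈ l`, lowers the total degree by one and
`totalDegree f ≤ length l`, then `𝐃_l f` is the constant `C (constantCoeff (𝐃_l f))`. -/
theorem planeWave_iter_eq_C (D : ι → Derivation R (MvPolynomial σ R) (MvPolynomial σ R))
    (l : List ι) (h : ∀ i ∈ l, ∀ f, (D i f).totalDegree ≤ f.totalDegree - 1)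
    (f : MvPolynomial σ R) (hf : f.totalDegree ≤ l.length) :
    l.foldr (fun i acc => D i acc) f = C (constantCoeff (l.foldr (fun i acc => D i acc) f)) := by
  have h0 : (l.foldr (fun i acc => D i acc) f).totalDegree = 0 := by
    have := planeWave_iter_totalDegree_le D l h f
    omega
  rw [totalDegree_eq_zero_iff_eq_C] at h0
  rw [constantCoeff_eq]
  exact h0

/-- **Abstract plane-wave link.** Let `D : ι → Derivation`, a derivation `E`, two renamings
`s t`, weights `μ z z' : ι → R`, a constant `a` and a list `l` satisfy, for every `i ∈ l`,
`D i ∘ E = E ∘ D i + μ i • D i`, `D i ∘ rename s = z i • rename s ∘ D i`,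
`D i ∘ rename t = z' i • rename t ∘ D i`, and let every `D i` lower the total degree by one.
Then for `totalDegree w ≤ length l` (so that `𝐃_l w` is a constant `κ`, killed by `E` and fixed
by renamings):
`constantCoeff (𝐃_l (E (E w) + (C a * w - rename s w - rename t w)))
  = ((Σ μ_i) ^ 2 + (a - Π z_i - Π z'_i)) * κ`. -/
theorem planeWave_link_generic (D : ι → Derivation R (MvPolynomial σ R) (MvPolynomial σ R))
    (E : Derivation R (MvPolynomial σ R) (MvPolynomial σ R)) (s t : σ → σ) (μ z z' : ι → R)
    (a : R) (l : List ι)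
    (hcomm : ∀ i ∈ l, ∀ f, D i (E f) = E (D i f) + μ i • D i f)
    (hup : ∀ i ∈ l, ∀ f, D i (rename s f) = z i • rename s (D i f))
    (hdown : ∀ i ∈ l, ∀ f, D i (rename t f) = z' i • rename t (D i f))
    (hdeg : ∀ i ∈ l, ∀ f, (D i f).totalDegree ≤ f.totalDegree - 1)
    (w : MvPolynomial σ R) (hw : w.totalDegree ≤ l.length) :
    constantCoeff (l.foldr (fun i acc => D i acc)
        (E (E w) + (C a * w - rename s w - rename t w))) =
      ((l.map μ).sum ^ 2 + (a - (l.map z).prod - (l.map z').prod)) *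
        constantCoeff (l.foldr (fun i acc => D i acc) w) := by
  have hC := planeWave_iter_eq_C D l hdeg w hw
  set κ := constantCoeff (l.foldr (fun i acc => D i acc) w)
  rw [planeWave_iter_add, planeWave_iter_sub, planeWave_iter_sub,
    planeWave_iter_comm D E μ l hcomm, planeWave_iter_comm D E μ l hcomm, hC,
    planeWave_iter_C_mul, hC, planeWave_iter_rename D s z l hup, hC,
    planeWave_iter_rename D t z' l hdown, hC]
  simp only [map_add, Derivation.map_smul, derivation_C, smul_zero, zero_add, rename_C]
  simp only [smul_eq_C_mul, map_mul, map_sub, constantCoeff_C]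
  ring

end Generic

section HarmonicChain

/-! ### The harmonic chain: bracket and shift relations of a single plane wave

Here `σ = ℤ ⊕ ℤ` over a field `K`; a derivation `D` is the plane wave `D_(z,μ)` when
`D q_x = C (z ^ x)` and `D p_x = C (μ * z ^ x)`, and `E` is the harmonic Liouville derivation
with pinning constant `a = ω₂ + 2` when `E q_x = p_x`, `E p_x = -(C a * q_x) + q_{x+1} + q_{x-1}`
(these generator identities are `MvPolynomial.mkDerivation_X` for the concrete operators). -/

variable {K : Type*} [Field K]

/-- **Bracket relation `[D_(z,μ), L₁] = μ • D_(z,μ)`** for an admissible wave (`z ≠ 0`,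
`μ ^ 2 = -(a - z - z⁻¹)`): `D (L₁ f) = L₁ (D f) + μ • D f`. On `q_x` both sides are
`C (μ z ^ x)`; on `p_x` the identity is `-a z^x + z^{x+1} + z^{x-1} = μ² z^x`. -/
theorem planeWave_bracket (a z μ : K) (hz : z ≠ 0) (hμ : μ ^ 2 = -(a - z - z⁻¹))
    (D E : Derivation K (MvPolynomial (ℤ ⊕ ℤ) K) (MvPolynomial (ℤ ⊕ ℤ) K))
    (hDq : ∀ x : ℤ, D (X (Sum.inl x)) = C (z ^ x))
    (hDp : ∀ x : ℤ, D (X (Sum.inr x)) = C (μ * z ^ x))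
    (hEq : ∀ x : ℤ, E (X (Sum.inl x)) = X (Sum.inr x))
    (hEp : ∀ x : ℤ, E (X (Sum.inr x)) =
      -(C a * X (Sum.inl x)) + X (Sum.inl (x + 1)) + X (Sum.inl (x - 1)))
    (f : MvPolynomial (ℤ ⊕ ℤ) K) : D (E f) = E (D f) + μ • D f := by
  refine planeWave_comm_of_X D E μ (fun i => ?_) f
  rcases i with x | x
  · rw [hEq, hDp, hDq, derivation_C, zero_add, smul_eq_C_mul, ← map_mul]
  · have hμ' : (C μ : MvPolynomial (ℤ ⊕ ℤ) K) * C μ = -(C a - C z - C z⁻¹) := by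
      rw [← map_mul, ← pow_two, hμ]
      simp only [map_neg, map_sub]
    rw [hEp, hDp, derivation_C, zero_add, map_add, map_add, map_neg, Derivation.leibniz,
      derivation_C, smul_zero, add_zero, smul_eq_mul, hDq, hDq, hDq, zpow_add_one₀ hz,
      zpow_sub_one₀ hz, smul_eq_C_mul]
    simp only [map_mul]
    linear_combination (-(C (z ^ x) : MvPolynomial (ℤ ⊕ ℤ) K)) * hμ'

/-- **Shift relation `D_(z,μ) ∘ τ = z • τ ∘ D_(z,μ)`** (`z ≠ 0`),
`τ = rename (Sum.map (·+1) (·+1))`: on generators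
`D q_{x+1} = C (z ^ (x+1)) = z • τ (C (z ^ x))`. -/
theorem planeWave_shift_up (z μ : K) (hz : z ≠ 0)
    (D : Derivation K (MvPolynomial (ℤ ⊕ ℤ) K) (MvPolynomial (ℤ ⊕ ℤ) K))
    (hDq : ∀ x : ℤ, D (X (Sum.inl x)) = C (z ^ x))
    (hDp : ∀ x : ℤ, D (X (Sum.inr x)) = C (μ * z ^ x)) (f : MvPolynomial (ℤ ⊕ ℤ) K) :
    D (rename (Sum.map (fun i : ℤ => i + 1) (fun i : ℤ => i + 1)) f) =
      z • rename (Sum.map (fun i : ℤ => i + 1) (fun i : ℤ => i + 1)) (D f) := by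
  refine planeWave_rename_of_X D _ z (fun i => ?_) f
  rcases i with x | x
  · rw [Sum.map_inl, hDq, hDq, rename_C, smul_eq_C_mul, ← map_mul, zpow_add_one₀ hz, mul_comm]
  · rw [Sum.map_inr, hDp, hDp, rename_C, smul_eq_C_mul, ← map_mul, zpow_add_one₀ hz]
    congr 1
    ring

/-- **Inverse shift relation `D_(z,μ) ∘ τ⁻¹ = z⁻¹ • τ⁻¹ ∘ D_(z,μ)`** (`z ≠ 0`),
`τ⁻¹ = rename (Sum.map (·-1) (·-1))`. -/
theorem planeWave_shift_down (z μ : K) (hz : z ≠ 0)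
    (D : Derivation K (MvPolynomial (ℤ ⊕ ℤ) K) (MvPolynomial (ℤ ⊕ ℤ) K))
    (hDq : ∀ x : ℤ, D (X (Sum.inl x)) = C (z ^ x))
    (hDp : ∀ x : ℤ, D (X (Sum.inr x)) = C (μ * z ^ x)) (f : MvPolynomial (ℤ ⊕ ℤ) K) :
    D (rename (Sum.map (fun i : ℤ => i - 1) (fun i : ℤ => i - 1)) f) =
      z⁻¹ • rename (Sum.map (fun i : ℤ => i - 1) (fun i : ℤ => i - 1)) (D f) := by
  refine planeWave_rename_of_X D _ z⁻¹ (fun i => ?_) f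
  rcases i with x | x
  · rw [Sum.map_inl, hDq, hDq, rename_C, smul_eq_C_mul, ← map_mul, zpow_sub_one₀ hz, mul_comm]
  · rw [Sum.map_inr, hDp, hDp, rename_C, smul_eq_C_mul, ← map_mul, zpow_sub_one₀ hz]
    congr 1
    ring

/-- **Stub C `stub_planeWaveLink` (plane-wave spectral transform of the harmonic operator).**
For every `ω₂`, every `n`, every lattice polynomial `w` of total degree `≤ n` and every family
`P : Fin n → ℂ × ℂ` of admissible plane waves (`z_j ≠ 0`, `μ_j ^ 2 = -ω̃(z_j)`,
`ω̃(z) = ω₂ + 2 - z - z⁻¹`), the iterated plane-wave derivative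
`𝐃_P = D_{P 0} ∘ ⋯ ∘ D_{P (n-1)}` intertwines the degree-preserving harmonic operator
`𝒟₀ w = L₁ (L₁ w) + ((ω₂+2) w - τ w - τ⁻¹ w)` with multiplication by the multiplier
`t(P) = (Σ_j μ_j)² + ω̃(Π_j z_j)` on constant coefficients:
`constantCoeff (𝐃_P (𝒟₀ w)) = t(P) * constantCoeff (𝐃_P w)`.
Proof: `planeWave_link_generic` for the list `List.ofFn P`, the generator identities being
`mkDerivation_X`, then `Fin.sum_ofFn`, `Fin.prod_ofFn`, `Finset.prod_inv_distrib`. -/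
theorem stub_planeWaveLink :
    ∀ (ω₂ : ℝ) (n : ℕ) (w : MvPolynomial (ℤ ⊕ ℤ) ℂ), w.totalDegree ≤ n →
    ∀ P : Fin n → ℂ × ℂ, (∀ j, (P j).1 ≠ 0 ∧ (P j).2 ^ 2 = -((ω₂ : ℂ) + 2 - (P j).1 - ((P j).1)⁻¹)) →
      MvPolynomial.constantCoeff ((List.ofFn P).foldr (fun (Pj : ℂ × ℂ) (acc : MvPolynomial (ℤ ⊕ ℤ) ℂ) => MvPolynomial.mkDerivation ℂ (Sum.elim (fun x : ℤ => (MvPolynomial.C (Pj.1 ^ x) : MvPolynomial (ℤ ⊕ ℤ) ℂ)) (fun x : ℤ => MvPolynomial.C (Pj.2 * Pj.1 ^ x))) acc) ((MvPolynomial.mkDerivation ℂ (Sum.elim (fun i : ℤ => (MvPolynomial.X (Sum.inr i) : MvPolynomial (ℤ ⊕ ℤ) ℂ)) (fun i : ℤ => -(MvPolynomial.C ((ω₂ : ℂ) + 2) * MvPolynomial.X (Sum.inl i)) + MvPolynomial.X (Sum.inl (i + 1)) + MvPolynomial.X (Sum.inl (i - 1))))) ((MvPolynomial.mkDerivation ℂ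 (Sum.elim (fun i : ℤ => (MvPolynomial.X (Sum.inr i) : MvPolynomial (ℤ ⊕ ℤ) ℂ)) (fun i : ℤ => -(MvPolynomial.C ((ω₂ : ℂ) + 2) * MvPolynomial.X (Sum.inl i)) + MvPolynomial.X (Sum.inl (i + 1)) + MvPolynomial.X (Sum.inl (i - 1))))) (w)) + (MvPolynomial.C ((ω₂ : ℂ) + 2) * (w) - MvPolynomial.rename (Sum.map (fun i : ℤ => i + 1) (fun i : ℤ => i + 1)) (w) - MvPolynomial.rename (Sum.map (fun i : ℤ => i - 1) (fun i : ℤ => i - 1)) (w)))) =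
        ((∑ j, (P j).2) ^ 2 + ((ω₂ : ℂ) + 2 - (∏ j, (P j).1) - (∏ j, (P j).1)⁻¹)) * MvPolynomial.constantCoeff ((List.ofFn P).foldr (fun (Pj : ℂ × ℂ) (acc : MvPolynomial (ℤ ⊕ ℤ) ℂ) => MvPolynomial.mkDerivation ℂ (Sum.elim (fun x : ℤ => (MvPolynomial.C (Pj.1 ^ x) : MvPolynomial (ℤ ⊕ ℤ) ℂ)) (fun x : ℤ => MvPolynomial.C (Pj.2 * Pj.1 ^ x))) acc) (w)) := by
  intro ω₂ n w hw P hP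
  have hl : ∀ Pj ∈ List.ofFn P, Pj.1 ≠ 0 ∧ Pj.2 ^ 2 = -((ω₂ : ℂ) + 2 - Pj.1 - Pj.1⁻¹) :=
    List.forall_mem_ofFn_iff.mpr hP
  have hw' : w.totalDegree ≤ (List.ofFn P).length := by rwa [List.length_ofFn]
  have key := planeWave_link_generic
    (fun Pj : ℂ × ℂ => MvPolynomial.mkDerivation ℂ
      (Sum.elim (fun x : ℤ => (MvPolynomial.C (Pj.1 ^ x) : MvPolynomial (ℤ ⊕ ℤ) ℂ))
        (fun x : ℤ => MvPolynomial.C (Pj.2 * Pj.1 ^ x))))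
    (MvPolynomial.mkDerivation ℂ
      (Sum.elim (fun i : ℤ => (MvPolynomial.X (Sum.inr i) : MvPolynomial (ℤ ⊕ ℤ) ℂ))
        (fun i : ℤ => -(MvPolynomial.C ((ω₂ : ℂ) + 2) * MvPolynomial.X (Sum.inl i)) +
          MvPolynomial.X (Sum.inl (i + 1)) + MvPolynomial.X (Sum.inl (i - 1)))))
    (Sum.map (fun i : ℤ => i + 1) (fun i : ℤ => i + 1))
    (Sum.map (fun i : ℤ => i - 1) (fun i : ℤ => i - 1))
    Prod.snd Prod.fst (fun Pj : ℂ × ℂ => Pj.1⁻¹) ((ω₂ : ℂ) + 2) (List.ofFn P)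
    (fun Pj hPj f => planeWave_bracket _ Pj.1 Pj.2 (hl Pj hPj).1 (hl Pj hPj).2 _ _
      (fun x => by exact mkDerivation_X _ _ _) (fun x => by exact mkDerivation_X _ _ _)
      (fun x => by exact mkDerivation_X _ _ _) (fun x => by exact mkDerivation_X _ _ _) f)
    (fun Pj hPj f => planeWave_shift_up Pj.1 Pj.2 (hl Pj hPj).1 _
      (fun x => by exact mkDerivation_X _ _ _) (fun x => by exact mkDerivation_X _ _ _) f)
    (fun Pj hPj f => planeWave_shift_down Pj.1 Pj.2 (hl Pj hPj).1 _
      (fun x => by exact mkDerivation_X _ _ _) (fun x => by exact mkDerivation_X _ _ _) f)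
    (fun Pj _ f => planeWave_totalDegree_mkDerivation_le _
      (fun i => by rcases i with x | x <;> simp only [Sum.elim_inl, Sum.elim_inr, totalDegree_C])
      f)
    w hw'
  simp only [List.map_ofFn, Fin.sum_ofFn, Fin.prod_ofFn, Function.comp_apply,
    Finset.prod_inv_distrib] at key
  exact key

end HarmonicChain

end Summit.AtomisticToContinuum.FouriersLaw.Theorems.DressedCharge

end
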